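import Literature.Analysis.OperatorTheory.KernelIterateBridge
import Literature.Analysis.OperatorTheory.IntegralOperatorHilbertSchmidt
import HarnessLib

/-!
# Spectral trace formulas for the cyclic integrals of a positive Hilbert–Schmidt kernel

Topic `Literature/Analysis/OperatorTheory`; companion of `PositiveKernelTransferOperator.lean` (the `L²`
transfer operator `A` of a bounded symmetric kernel `K` on a finite measure space, `A φ =ᵐ ∫ K(·,y) φ(y)`),
`KernelIterateBridge.lean` (`⟪k_u, A^j [h]⟫ = (κ^[j+1] h)(u)` for the kernel sections `k_u = K(u, ·)`),
`IntegralOperatorHilbertSchmidt.lean` (`Σᵢ ‖A eᵢ‖² = ∬ K²`) and `CompactSelfAdjointEigenbasis.lean` (a compact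
self-adjoint operator has a Hilbert basis of eigenvectors).  GIVEN such an eigenbasis `(bᵢ)`, `A bᵢ = λᵢ bᵢ`,
this file turns the nested kernel integrals produced by peeling cyclic path integrals
(`KernelCyclicPeeling.lean`, `HeterogeneousCyclicPeeling.lean`) into spectral sums — the trace formulas of
the transfer-matrix method for time-sliced models with periodic boundary conditions, WITHOUT a trace class:

* `pow_apply_basis`, `inner_kernel_section_basis`, `hasSum_lam_sq` — bookkeeping: `A^j bᵢ = λᵢ^j bᵢ`,
  `⟪k_x, bᵢ⟫ = (κ bᵢ)(x) := ∫ K(x,y) bᵢ(y)`, `Σᵢ λᵢ² = ∬ K² < ∞`;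
* `hasSum_inner_kernel_section_pow` — the pointwise expansion
  `⟪k_x, A^j k_y⟫ = Σᵢ λᵢ^j (κ bᵢ)(x) (κ bᵢ)(y)` for EVERY `x, y` (Parseval; no null sets);
* `hasSum_pow_integral_iterate_diag` — **trace of powers**: `∫ (κ^[M+1] K(·,x))(x) dμ(x) = Σᵢ λᵢ^{M+2}` for
  non-negative eigenvalues (the cyclic integral of `M + 2` copies of `K`);
* `hasSum_integral_iterate_insert_one` — **one bond insertion**: for a second bounded kernel `X` with `L²`
  operator `𝒳`, `∫∫ X(x,y) (κ^[M+1] K(·,x))(y) = Σᵢ λᵢ^{M+2} ⟪bᵢ, 𝒳 bᵢ⟫`;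
* the two-insertion formula is in the continuation file `PositiveKernelSpectralTraceTwo.lean`.

Mathlib + the companion files only; no definitions (`κ`, the sections and the coefficients are written out).
References: M. Reed, B. Simon, *Methods of Modern Mathematical Physics I* (1980), Thm. VI.22–VI.23;
B. Simon, *Trace Ideals and Their Applications* (2005), Thm. 2.12 / 3.1 (trace of a product of two
Hilbert–Schmidt operators as an integral of kernels). [folklore]
-/

noncomputable section

open MeasureTheory Filter Set Function
open scoped RealInnerProductSpace ENNReal

namespace Literature.Analysis.OperatorTheory

variable {X : Type*} [MeasurableSpace X] {μ : Measure X} [IsFiniteMeasure μ]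
  {K : X → X → ℝ} {C : ℝ} {A : Lp ℝ 2 μ →L[ℝ] Lp ℝ 2 μ} {ι : Type*}
  {b : HilbertBasis ι ℝ (Lp ℝ 2 μ)} {lam : ι → ℝ}

/-! ### Eigenbasis bookkeeping -/

omit [IsFiniteMeasure μ] in
/-- Powers act diagonally on an eigenbasis: `A^j bᵢ = λᵢ^j bᵢ`. [folklore] -/
theorem pow_apply_basis (hb : ∀ i, A (b i) = lam i • b i) (j : ℕ) (i : ι) :
    (A ^ j) (b i) = lam i ^ j • b i := by
  induction j with
  | zero => simp
  | succ j ih =>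
    rw [pow_succ', mul_apply_eq_comp, ih, map_smul, hb, smul_smul, pow_succ, mul_comm]

omit [IsFiniteMeasure μ] in
/-- The eigenvalue is the diagonal matrix element: `λᵢ = ⟪bᵢ, A bᵢ⟫`. [folklore] -/
theorem lam_eq_inner (hb : ∀ i, A (b i) = lam i • b i) (i : ι) : lam i = ⟪b i, A (b i)⟫ := by
  rw [hb, inner_smul_right, real_inner_self_eq_norm_sq, b.orthonormal.norm_eq_one i]
  ring

omit [IsFiniteMeasure μ] in
/-- `|λᵢ| ≤ ‖A‖`. [folklore] -/
theorem abs_lam_le_norm (hb : ∀ i, A (b i) = lam i • b i) (i : ι) : |lam i| ≤ ‖A‖ := by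
  have h1 : ‖A (b i)‖ = |lam i| := by
    rw [hb, norm_smul, Real.norm_eq_abs, b.orthonormal.norm_eq_one i, mul_one]
  rw [← h1]
  calc ‖A (b i)‖ ≤ ‖A‖ * ‖b i‖ := A.le_opNorm _
    _ = ‖A‖ := by rw [b.orthonormal.norm_eq_one i, mul_one]

/-- **The section coefficients**: `⟪k_x, bᵢ⟫ = (κ bᵢ)(x) = ∫ K(x,y) bᵢ(y) dμ(y)`. [folklore] -/
theorem inner_kernel_section_basis (hK : StronglyMeasurable (uncurry K)) (hC : ∀ x y, ‖K x y‖ ≤ C)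
    (b : HilbertBasis ι ℝ (Lp ℝ 2 μ)) (x : X) (i : ι) :
    ⟪(memLp_kernel_section (μ := μ) hK hC x).toLp (K x), b i⟫ = ∫ y, K x y * b i y ∂μ := by
  rw [real_inner_comm, inner_kernel_section hK hC]
  exact integral_congr_ae (Eventually.of_forall fun y => mul_comm _ _)

/-- The transfer operator applied to a basis vector is the class of the honest function `κ bᵢ`. [folklore] -/
theorem apply_basis_eq_toLp (hK : StronglyMeasurable (uncurry K)) (hC : ∀ x y, ‖K x y‖ ≤ C)
    (hA : ∀ φ : Lp ℝ 2 μ, (A φ : X → ℝ) =ᵐ[μ] fun x => ∫ y, K x y * φ y ∂μ) (b : HilbertBasis ι ℝ (Lp ℝ 2 μ))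
    (i : ι) : A (b i) = (memLp_two_integral_kernel_mul hK hC (b i)).toLp _ :=
  Lp.ext ((hA (b i)).trans (memLp_two_integral_kernel_mul hK hC (b i)).coeFn_toLp.symm)

/-- **`Σᵢ λᵢ² = ∬ K²`** (Hilbert–Schmidt): in particular the eigenvalues are square summable. [folklore] -/
theorem hasSum_lam_sq [Countable ι] (hK : StronglyMeasurable (uncurry K)) (hC : ∀ x y, ‖K x y‖ ≤ C)
    (hA : ∀ φ : Lp ℝ 2 μ, (A φ : X → ℝ) =ᵐ[μ] fun x => ∫ y, K x y * φ y ∂μ)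
    (hb : ∀ i, A (b i) = lam i • b i) :
    HasSum (fun i => lam i ^ 2) (∫ x, ∫ y, ‖K x y‖ ^ 2 ∂μ ∂μ) := by
  have h := hasSum_norm_toLp_integral_kernel_mul_sq (𝕜 := ℝ) hK hC b
  convert h using 2 with i
  rw [← apply_basis_eq_toLp hK hC hA b i, hb, norm_smul, Real.norm_eq_abs, b.orthonormal.norm_eq_one i,
    mul_one, sq_abs]

/-- The eigenvalue powers `λᵢ^{m+2}` are absolutely summable. [folklore] -/
theorem summable_abs_lam_pow [Countable ι] (hK : StronglyMeasurable (uncurry K)) (hC : ∀ x y, ‖K x y‖ ≤ C)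
    (hA : ∀ φ : Lp ℝ 2 μ, (A φ : X → ℝ) =ᵐ[μ] fun x => ∫ y, K x y * φ y ∂μ)
    (hb : ∀ i, A (b i) = lam i • b i) (m : ℕ) :
    Summable fun i => |lam i| ^ (m + 2) := by
  have hs := (hasSum_lam_sq hK hC hA hb).summable
  refine (hs.mul_left (‖A‖ ^ m)).of_nonneg_of_le (fun i => by positivity) fun i => ?_
  calc |lam i| ^ (m + 2) = |lam i| ^ m * |lam i| ^ 2 := pow_add _ _ _
    _ ≤ ‖A‖ ^ m * |lam i| ^ 2 :=
        mul_le_mul_of_nonneg_right (pow_le_pow_left₀ (abs_nonneg _) (abs_lam_le_norm hb i) m) (sq_nonneg _)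
    _ = ‖A‖ ^ m * lam i ^ 2 := by rw [sq_abs]

/-! ### The pointwise spectral expansion of the iterated kernel -/

/-- **`⟪k_x, A^j k_y⟫ = Σᵢ λᵢ^j (κ bᵢ)(x) (κ bᵢ)(y)` for every `x, y`** (Parseval for the kernel sections and
self-adjointness of `A^j`).  With `KernelIterateBridge.inner_kernel_section_pow_kernelOp` the left-hand side is the
iterated kernel `K^{(j+2)}(x, y) = (κ^[j+1] K(·, y))(x)`. [folklore] -/
theorem hasSum_inner_kernel_section_pow (hK : StronglyMeasurable (uncurry K)) (hC : ∀ x y, ‖K x y‖ ≤ C)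
    (hsymm : ∀ x y, K x y = K y x)
    (hA : ∀ φ : Lp ℝ 2 μ, (A φ : X → ℝ) =ᵐ[μ] fun x => ∫ y, K x y * φ y ∂μ)
    (hb : ∀ i, A (b i) = lam i • b i) (j : ℕ) (x y : X) :
    HasSum (fun i => lam i ^ j * (∫ z, K x z * b i z ∂μ) * (∫ z, K y z * b i z ∂μ))
      ⟪(memLp_kernel_section (μ := μ) hK hC x).toLp (K x),
        (A ^ j) ((memLp_kernel_section (μ := μ) hK hC y).toLp (K y))⟫ := by
  set kx : Lp ℝ 2 μ := (memLp_kernel_section (μ := μ) hK hC x).toLp (K x)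
  set ky : Lp ℝ 2 μ := (memLp_kernel_section (μ := μ) hK hC y).toLp (K y)
  have hsa : IsSelfAdjoint (A ^ j) := (isSelfAdjoint_kernelOp hK hC hsymm hA).pow j
  have h := b.hasSum_inner_mul_inner kx ((A ^ j) ky)
  have key : (fun i => lam i ^ j * (∫ z, K x z * b i z ∂μ) * (∫ z, K y z * b i z ∂μ)) =
      fun i => ⟪kx, b i⟫ * ⟪b i, (A ^ j) ky⟫ := by
    funext i
    have h2 : ⟪b i, (A ^ j) ky⟫ = lam i ^ j * ⟪b i, ky⟫ := by
      rw [← hsa.adjoint_eq, ContinuousLinearMap.adjoint_inner_right, pow_apply_basis hb j i, inner_smul_left]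
      rfl
    rw [h2, inner_kernel_section_basis hK hC b x i, real_inner_comm, inner_kernel_section_basis hK hC b y i]
    ring
  rw [key]
  exact h

/-- The iterated kernel is the inner product of sections: `(κ^[j+1] K(·, y))(x) = ⟪k_x, A^j k_y⟫`. [folklore] -/
theorem iterate_kernel_eq_inner (hK : StronglyMeasurable (uncurry K)) (hC : ∀ x y, ‖K x y‖ ≤ C)
    (hsymm : ∀ x y, K x y = K y x)
    (hA : ∀ φ : Lp ℝ 2 μ, (A φ : X → ℝ) =ᵐ[μ] fun x => ∫ y, K x y * φ y ∂μ) (j : ℕ) (x y : X) :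
    ((fun f : X → ℝ => fun w => ∫ z, K w z * f z ∂μ)^[j + 1] (fun z => K z y)) x =
      ⟪(memLp_kernel_section (μ := μ) hK hC x).toLp (K x),
        (A ^ j) ((memLp_kernel_section (μ := μ) hK hC y).toLp (K y))⟫ := by
  have hKy : (fun z => K z y) = K y := funext fun z => hsymm z y
  rw [hKy, inner_kernel_section_pow_kernelOp hK hC hsymm hA (hK.measurable.of_uncurry_left) (fun z => hC y z) j x]

/-- **Pointwise Parseval bound for the section coefficients**: `Σᵢ (κ bᵢ)(x)² = ∫ K(x,·)² ≤ C² μ(X)`. [folklore] -/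
theorem tsum_sq_integral_kernel_mul_le (hK : StronglyMeasurable (uncurry K)) (hC : ∀ x y, ‖K x y‖ ≤ C)
    (b : HilbertBasis ι ℝ (Lp ℝ 2 μ)) (x : X) :
    Summable (fun i => (∫ z, K x z * b i z ∂μ) ^ 2) ∧
      ∑' i, (∫ z, K x z * b i z ∂μ) ^ 2 ≤ C ^ 2 * μ.real univ := by
  have h := hasSum_norm_sq_integral_kernel_mul (𝕜 := ℝ) hK hC b x
  simp only [Real.norm_eq_abs, sq_abs] at h
  refine ⟨h.summable, ?_⟩
  rw [h.tsum_eq]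
  calc ∫ z, K x z ^ 2 ∂μ ≤ ∫ _z, C ^ 2 ∂μ := by
        refine integral_mono_of_nonneg (Eventually.of_forall fun z => sq_nonneg _) (integrable_const _)
          (Eventually.of_forall fun z => ?_)
        have h1 := hC x z
        rw [Real.norm_eq_abs] at h1
        have h2 : |K x z| ^ 2 ≤ C ^ 2 := pow_le_pow_left₀ (abs_nonneg _) h1 2
        rw [sq_abs] at h2
        exact h2
    _ = C ^ 2 * μ.real univ := by rw [integral_const, smul_eq_mul, mul_comm]

/-! ### Trace of powers -/

/-- `∫ (κ bᵢ)² = λᵢ²` (the `L²` norm of `A bᵢ = λᵢ bᵢ`). [folklore] -/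
theorem integral_sq_integral_kernel_mul_basis (hK : StronglyMeasurable (uncurry K)) (hC : ∀ x y, ‖K x y‖ ≤ C)
    (hA : ∀ φ : Lp ℝ 2 μ, (A φ : X → ℝ) =ᵐ[μ] fun x => ∫ y, K x y * φ y ∂μ)
    (hb : ∀ i, A (b i) = lam i • b i) (i : ι) :
    ∫ x, (∫ z, K x z * b i z ∂μ) ^ 2 ∂μ = lam i ^ 2 := by
  have h := norm_toLp_sq_eq_integral_norm_sq (𝕜 := ℝ) (memLp_two_integral_kernel_mul hK hC (b i))
  simp only [Real.norm_eq_abs, sq_abs] at h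
  rw [← h, ← apply_basis_eq_toLp hK hC hA b i, hb, norm_smul, Real.norm_eq_abs, b.orthonormal.norm_eq_one i,
    mul_one, sq_abs]

/-- The section coefficient `x ↦ (κ bᵢ)(x)` is measurable. [folklore] -/
theorem measurable_integral_kernel_mul_basis (hK : StronglyMeasurable (uncurry K)) (b : HilbertBasis ι ℝ (Lp ℝ 2 μ))
    (i : ι) : Measurable fun x => ∫ z, K x z * b i z ∂μ :=
  (stronglyMeasurable_integral_kernel_mul hK (b i)).measurable

/-- **Trace of powers.**  For non-negative eigenvalues, the diagonal integral of the `(M+2)`-fold iterated kernel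
— the cyclic integral of `M + 2` copies of `K` (`KernelCyclicPeeling`, `HeterogeneousCyclicPeeling`) — is
`Σᵢ λᵢ^{M+2}`:  `∫ (κ^[M+1] K(·, x))(x) dμ(x) = Σᵢ λᵢ^{M+2}` (`Tr A^{M+2}` without a trace class). [folklore] -/
theorem hasSum_pow_integral_iterate_diag [Countable ι] (hK : StronglyMeasurable (uncurry K))
    (hC : ∀ x y, ‖K x y‖ ≤ C) (hsymm : ∀ x y, K x y = K y x)
    (hA : ∀ φ : Lp ℝ 2 μ, (A φ : X → ℝ) =ᵐ[μ] fun x => ∫ y, K x y * φ y ∂μ)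
    (hb : ∀ i, A (b i) = lam i • b i) (hlam : ∀ i, 0 ≤ lam i) (M : ℕ) :
    HasSum (fun i => lam i ^ (M + 2))
      (∫ x, ((fun f : X → ℝ => fun w => ∫ z, K w z * f z ∂μ)^[M + 1] (fun z => K z x)) x ∂μ) := by
  -- the terms `f i x = λᵢ^M (κ bᵢ)(x)²`
  set c : ι → X → ℝ := fun i x => ∫ z, K x z * b i z ∂μ with hc
  set f : ι → X → ℝ := fun i x => lam i ^ M * c i x ^ 2 with hf
  have hcm : ∀ i, Measurable (c i) := fun i => measurable_integral_kernel_mul_basis hK b i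
  have hfm : ∀ i, Measurable (f i) := fun i => ((hcm i).pow_const 2).const_mul _
  have hf0 : ∀ i x, 0 ≤ f i x := fun i x => mul_nonneg (pow_nonneg (hlam i) M) (sq_nonneg _)
  -- pointwise expansion of the integrand
  have hpt : ∀ x, HasSum (fun i => f i x)
      (((fun f : X → ℝ => fun w => ∫ z, K w z * f z ∂μ)^[M + 1] (fun z => K z x)) x) := fun x => by
    rw [iterate_kernel_eq_inner hK hC hsymm hA M x x]
    have h := hasSum_inner_kernel_section_pow hK hC hsymm hA hb M x x
    simp only [hf, hc, sq]
    convert h using 2 with i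
    ring
  have hint_eq : ∀ x, ((fun f : X → ℝ => fun w => ∫ z, K w z * f z ∂μ)^[M + 1] (fun z => K z x)) x =
      ∑' i, f i x := fun x => (hpt x).tsum_eq.symm
  simp_rw [hint_eq]
  -- each term integrates to `λᵢ^{M+2}`
  have hfi : ∀ i, ∫ x, f i x ∂μ = lam i ^ (M + 2) := fun i => by
    simp only [hf]
    rw [integral_const_mul, integral_sq_integral_kernel_mul_basis hK hC hA hb i, ← pow_add]
  -- bound for Tonelli: `∫⁻ ‖f i‖ = λᵢ^{M+2}`
  have hfint : ∀ i, Integrable (f i) μ := fun i => by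
    refine Integrable.of_bound (hfm i).aestronglyMeasurable (‖A‖ ^ M * (C ^ 2 * μ.real univ))
      (Eventually.of_forall fun x => ?_)
    rw [Real.norm_eq_abs, abs_of_nonneg (hf0 i x), hf]
    dsimp only
    refine mul_le_mul (pow_le_pow_left₀ (hlam i) ((le_abs_self _).trans (abs_lam_le_norm hb i)) M) ?_
      (sq_nonneg _) (by positivity)
    obtain ⟨hsx, hlex⟩ := tsum_sq_integral_kernel_mul_le (μ := μ) hK hC b x
    exact (hsx.le_tsum i fun j _ => sq_nonneg _).trans hlex
  have hsum : Summable fun i => lam i ^ (M + 2) := by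
    have h := summable_abs_lam_pow hK hC hA hb M
    refine h.congr fun i => ?_
    rw [abs_of_nonneg (hlam i)]
  have hlint : ∑' i, ∫⁻ x, ‖f i x‖ₑ ∂μ ≠ ∞ := by
    have h1 : ∀ i, ∫⁻ x, ‖f i x‖ₑ ∂μ = ENNReal.ofReal (lam i ^ (M + 2)) := fun i => by
      rw [← hfi i, ofReal_integral_eq_lintegral_ofReal (hfint i) (Eventually.of_forall (hf0 i))]
      refine lintegral_congr fun x => ?_
      rw [Real.enorm_eq_ofReal (hf0 i x)]
    simp_rw [h1]
    rw [← ENNReal.ofReal_tsum_of_nonneg (fun i => pow_nonneg (hlam i) _) hsum]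
    exact ENNReal.ofReal_ne_top
  rw [integral_tsum (fun i => (hfm i).aestronglyMeasurable) hlint]
  simp_rw [hfi]
  exact hsum.hasSum

/-! ### One bond insertion -/

/-- Measurability of `x ↦ ∫ X(x,y) h(y) dμ(y)` for a jointly measurable kernel and a measurable bounded `h`.
[folklore] -/
theorem measurable_integral_kernel_mul_fun {Xk : X → X → ℝ} (hX : StronglyMeasurable (uncurry Xk))
    {h : X → ℝ} (hh : Measurable h) : Measurable fun x => ∫ y, Xk x y * h y ∂μ := by
  have h1 : StronglyMeasurable (uncurry fun x y => Xk x y * h y) :=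
    hX.mul (hh.stronglyMeasurable.comp_measurable measurable_snd)
  exact (StronglyMeasurable.integral_prod_right' (ν := μ) h1).measurable

/-- **One bond insertion.**  For a second bounded kernel `X` with `L²` operator `𝒳`
(`𝒳 φ =ᵐ ∫ X(·,y) φ(y)`), the nested integral produced by `integral_cyclic_insert_one` is a spectral sum:
`∫∫ X(x,y) (κ^[M+1] K(·,x))(y) dμ(y) dμ(x) = Σᵢ λᵢ^{M+2} ⟪bᵢ, 𝒳 bᵢ⟫` (`Tr(𝒳 A^{M+2})`). [folklore] -/
theorem hasSum_integral_iterate_insert_one [Countable ι] (hK : StronglyMeasurable (uncurry K))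
    (hC : ∀ x y, ‖K x y‖ ≤ C) (hsymm : ∀ x y, K x y = K y x)
    (hA : ∀ φ : Lp ℝ 2 μ, (A φ : X → ℝ) =ᵐ[μ] fun x => ∫ y, K x y * φ y ∂μ)
    (hb : ∀ i, A (b i) = lam i • b i) {Xk : X → X → ℝ} {CX : ℝ} (hX : StronglyMeasurable (uncurry Xk))
    (hCX : ∀ x y, ‖Xk x y‖ ≤ CX) {Xop : Lp ℝ 2 μ →L[ℝ] Lp ℝ 2 μ}
    (hXop : ∀ φ : Lp ℝ 2 μ, (Xop φ : X → ℝ) =ᵐ[μ] fun x => ∫ y, Xk x y * φ y ∂μ) (M : ℕ) :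
    HasSum (fun i => lam i ^ (M + 2) * ⟪b i, Xop (b i)⟫)
      (∫ x, ∫ y, Xk x y * ((fun f : X → ℝ => fun w => ∫ z, K w z * f z ∂μ)^[M + 1] (fun z => K z x)) y ∂μ ∂μ) := by
  -- notation: `c i x = (κ bᵢ)(x)`, `d i x = ∫ X(x,y) c i y`, `κ` the pointwise operator of `K`
  set κ : (X → ℝ) → X → ℝ := fun f w => ∫ z, K w z * f z ∂μ with hκ
  set c : ι → X → ℝ := fun i x => ∫ z, K x z * b i z ∂μ with hc
  set d : ι → X → ℝ := fun i x => ∫ y, Xk x y * c i y ∂μ with hd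
  have hcm : ∀ i, Measurable (c i) := fun i => measurable_integral_kernel_mul_basis hK b i
  have hdm : ∀ i, Measurable (d i) := fun i => measurable_integral_kernel_mul_fun hX (hcm i)
  have hlamA : ∀ i, |lam i| ≤ ‖A‖ := abs_lam_le_norm hb
  have hpars : ∀ x, Summable (fun i => c i x ^ 2) ∧ ∑' i, c i x ^ 2 ≤ C ^ 2 * μ.real univ :=
    fun x => tsum_sq_integral_kernel_mul_le hK hC b x
  have hsq_meas : Measurable fun x => ∫ z, ‖K x z‖ ^ 2 ∂μ := (stronglyMeasurable_integral_norm_kernel_sq hK).measurable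
  have hsq_eq : ∀ x, ∑' i, c i x ^ 2 = ∫ z, ‖K x z‖ ^ 2 ∂μ := fun x =>
    (hasSum_norm_sq_integral_kernel_mul (𝕜 := ℝ) hK hC b x |>.tsum_eq |> fun h => by
      simpa only [Real.norm_eq_abs, sq_abs] using h)
  have hlam2 : Summable fun i => lam i ^ 2 := (hasSum_lam_sq hK hC hA hb).summable
  -- (0) the pointwise expansion of the integrand
  have hpt : ∀ x y, HasSum (fun i => Xk x y * (lam i ^ M * c i y * c i x))
      (Xk x y * (κ^[M + 1] (fun z => K z x)) y) := fun x y => by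
    rw [iterate_kernel_eq_inner hK hC hsymm hA M y x]
    exact (hasSum_inner_kernel_section_pow hK hC hsymm hA hb M y x).mul_left _
  -- (1) level one: for each `x`, sum and `y`-integral commute (dominated convergence)
  have hlev1 : ∀ x, HasSum (fun i => lam i ^ M * c i x * d i x)
      (∫ y, Xk x y * (κ^[M + 1] (fun z => K z x)) y ∂μ) := by
    intro x
    have hCX0 : 0 ≤ CX := (norm_nonneg _).trans (hCX x x)
    have key := hasSum_integral_of_dominated_convergence (μ := μ)
      (F := fun i y => Xk x y * (lam i ^ M * c i y * c i x))
      (f := fun y => Xk x y * (κ^[M + 1] (fun z => K z x)) y)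
      (fun i y => CX * ‖A‖ ^ M * ((c i y ^ 2 + c i x ^ 2) / 2)) (fun i => ?_) (fun i => ?_) ?_ ?_
      (Eventually.of_forall fun y => hpt x y)
    · -- identify the terms
      refine key.congr_fun fun i => ?_
      simp only [hd]
      rw [← integral_const_mul]
      refine integral_congr_ae (Eventually.of_forall fun y => ?_)
      ring
    · exact (((hX.measurable.of_uncurry_left).mul (((hcm i).const_mul _).mul_const _))).aestronglyMeasurable
    · refine Eventually.of_forall fun y => ?_
      rw [norm_mul, norm_mul, norm_mul, Real.norm_eq_abs, Real.norm_eq_abs, Real.norm_eq_abs, Real.norm_eq_abs,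
        abs_pow]
      have h1 : |Xk x y| ≤ CX := by simpa [Real.norm_eq_abs] using hCX x y
      have h2 : |lam i| ^ M ≤ ‖A‖ ^ M := pow_le_pow_left₀ (abs_nonneg _) (hlamA i) M
      have h3 : |c i y| * |c i x| ≤ (c i y ^ 2 + c i x ^ 2) / 2 := by
        have hsq := two_mul_le_add_sq |c i y| |c i x|
        rw [sq_abs, sq_abs] at hsq
        linarith
      calc |Xk x y| * (|lam i| ^ M * |c i y| * |c i x|) = |Xk x y| * |lam i| ^ M * (|c i y| * |c i x|) := by ring
        _ ≤ CX * ‖A‖ ^ M * ((c i y ^ 2 + c i x ^ 2) / 2) := by gcongr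
    · exact Eventually.of_forall fun y => (((hpars y).1.add (hpars x).1).div_const 2).mul_left (CX * ‖A‖ ^ M)
    · -- the dominating function `y ↦ CX ‖A‖^M (∫ K(y,·)² + ∫ K(x,·)²) / 2` is integrable
      have hfun : (fun y => ∑' i, CX * ‖A‖ ^ M * ((c i y ^ 2 + c i x ^ 2) / 2)) =
          fun y => CX * ‖A‖ ^ M * ((∫ z, ‖K y z‖ ^ 2 ∂μ + ∫ z, ‖K x z‖ ^ 2 ∂μ) / 2) := by
        funext y
        rw [tsum_mul_left, tsum_div_const, (hpars y).1.tsum_add (hpars x).1, hsq_eq y, hsq_eq x]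
      rw [hfun]
      exact ((Integrable.of_bound hsq_meas.aestronglyMeasurable (C ^ 2 * μ.real univ)
        (Eventually.of_forall fun y => by
          rw [Real.norm_eq_abs, abs_of_nonneg (integral_nonneg fun z => by positivity), ← hsq_eq y]
          exact (hpars y).2)).add (integrable_const _)).div_const 2 |>.const_mul _
  -- (2) the terms: `∫ λᵢ^M cᵢ dᵢ = λᵢ^{M+2} ⟪bᵢ, 𝒳 bᵢ⟫`
  have hae : ∀ i, (A (b i) : X → ℝ) =ᵐ[μ] c i := fun i => hA (b i)
  have hterm : ∀ i, ∫ x, lam i ^ M * c i x * d i x ∂μ = lam i ^ (M + 2) * ⟪b i, Xop (b i)⟫ := by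
    intro i
    have h1 : ∫ x, c i x * d i x ∂μ = ⟪A (b i), Xop (A (b i))⟫ := by
      rw [inner_kernelOp_eq_integral hXop]
      refine integral_congr_ae ?_
      filter_upwards [hae i] with x hx
      rw [hx]
      simp only [hd]
      congr 1
      exact integral_congr_ae (by filter_upwards [hae i] with y hy; rw [hy])
    calc ∫ x, lam i ^ M * c i x * d i x ∂μ = lam i ^ M * ∫ x, c i x * d i x ∂μ := by
          rw [← integral_const_mul]
          exact integral_congr_ae (Eventually.of_forall fun x => by ring)
      _ = lam i ^ (M + 2) * ⟪b i, Xop (b i)⟫ := by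
          rw [h1, hb, map_smul, real_inner_smul_left, real_inner_smul_right]
          ring
  -- bound on `dᵢ`: `|dᵢ(x)| ≤ CX √μ(X) |λᵢ|`
  have hdb : ∀ i x, |d i x| ≤ CX * Real.sqrt (μ.real univ) * |lam i| := by
    intro i x
    have hCX0 : 0 ≤ CX := (norm_nonneg _).trans (hCX x x)
    have h1 : d i x = ∫ y, Xk x y * (A (b i)) y ∂μ := by
      simp only [hd]
      exact integral_congr_ae (by filter_upwards [hae i] with y hy; rw [hy])
    rw [h1]
    refine (abs_integral_kernel_mul_le hCX hCX0 (A (b i)) x).trans (le_of_eq ?_)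
    rw [hb, norm_smul, Real.norm_eq_abs, b.orthonormal.norm_eq_one i, mul_one]
  -- (3) level two: sum and `x`-integral commute (dominated convergence)
  have hlev2 : HasSum (fun i => ∫ x, lam i ^ M * c i x * d i x ∂μ)
      (∫ x, ∫ y, Xk x y * (κ^[M + 1] (fun z => K z x)) y ∂μ ∂μ) := by
    have key := hasSum_integral_of_dominated_convergence (μ := μ)
      (F := fun i x => lam i ^ M * c i x * d i x)
      (f := fun x => ∫ y, Xk x y * (κ^[M + 1] (fun z => K z x)) y ∂μ)
      (fun i x => ‖A‖ ^ M * (CX * Real.sqrt (μ.real univ)) * ((c i x ^ 2 + lam i ^ 2) / 2))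
      (fun i => ((((hcm i).const_mul _).mul (hdm i))).aestronglyMeasurable) (fun i => ?_) ?_ ?_
      (Eventually.of_forall fun x => hlev1 x)
    · exact key
    · refine Eventually.of_forall fun x => ?_
      rw [Real.norm_eq_abs, abs_mul, abs_mul, abs_pow]
      have hCX0 : 0 ≤ CX := (norm_nonneg _).trans (hCX x x)
      have h2 : |lam i| ^ M ≤ ‖A‖ ^ M := pow_le_pow_left₀ (abs_nonneg _) (hlamA i) M
      have h3 : |c i x| * |lam i| ≤ (c i x ^ 2 + lam i ^ 2) / 2 := by
        have hsq := two_mul_le_add_sq |c i x| |lam i|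
        rw [sq_abs, sq_abs] at hsq
        linarith
      calc |lam i| ^ M * |c i x| * |d i x| ≤ ‖A‖ ^ M * |c i x| * (CX * Real.sqrt (μ.real univ) * |lam i|) := by
            gcongr
            exact hdb i x
        _ = ‖A‖ ^ M * (CX * Real.sqrt (μ.real univ)) * (|c i x| * |lam i|) := by ring
        _ ≤ ‖A‖ ^ M * (CX * Real.sqrt (μ.real univ)) * ((c i x ^ 2 + lam i ^ 2) / 2) := by gcongr
    · exact Eventually.of_forall fun x => (((hpars x).1.add hlam2).div_const 2).mul_left _
    · have hfun : (fun x => ∑' i, ‖A‖ ^ M * (CX * Real.sqrt (μ.real univ)) * ((c i x ^ 2 + lam i ^ 2) / 2)) =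
          fun x => ‖A‖ ^ M * (CX * Real.sqrt (μ.real univ)) * ((∫ z, ‖K x z‖ ^ 2 ∂μ + ∑' i, lam i ^ 2) / 2) := by
        funext x
        rw [tsum_mul_left, tsum_div_const, (hpars x).1.tsum_add hlam2, hsq_eq x]
      rw [hfun]
      exact ((Integrable.of_bound hsq_meas.aestronglyMeasurable (C ^ 2 * μ.real univ)
        (Eventually.of_forall fun y => by
          rw [Real.norm_eq_abs, abs_of_nonneg (integral_nonneg fun z => by positivity), ← hsq_eq y]
          exact (hpars y).2)).add (integrable_const _)).div_const 2 |>.const_mul _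
  -- (4) assemble
  simpa only [hterm] using hlev2

end Literature.Analysis.OperatorTheory

end
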